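import Summits.AtomisticToContinuum.BoseEinsteinCondensation.Theorems.BECRieszReverseHolderCoarseGrainedReverseHolderStubRieszKernelOnsagerBound
import Summits.AtomisticToContinuum.BoseEinsteinCondensation.Theorems.BECRieszReverseHolderCoarseGrainedReverseHolderStubGibbsMeanEnergyNonpos
import Literature.MathematicalPhysics.StatisticalMechanics.PeriodicRieszKernelFourier
import Literature.MathematicalPhysics.QuantumManyBody.PeriodicBoseGas
import Literature.MathematicalPhysics.QuantumManyBody.OnsagerInequality
import HarnessLib

/-!
# Assembly of the classical engine in variance form (route BECRieszReverseHolder)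

Line `registered` of crux stmt-AtomisticToContinuum-12840 `CoarseGrainedReverseHolder`; registered
sub-goal `stub_structureFactorBound_of` (S4′C): the `L`-uniform smooth structure-factor bound of the
one-component smeared periodic Riesz-2 gas at every coupling `b ≥ 0`, assembled from its two halves
taken as hypotheses.

Notation: `g = periodicRieszKernel 2 L η`, `Θ_{L,t} = periodicHeatSum L t`,
`K₂ = rieszSubordinationConst 2 > 0`, `D_t(X) = Σ_{i,j} Θ_{L,t}(X_i − X_j)` (diagonal included),
`H(X) = Σ_{i<j} g(X_i − X_j)`.

* hypothesis A (pointwise, S4′A): `2 K₂ (√t₀ − η) D_{t₀}(X) ≤ Σ_{i,j} g(X_i − X_j)`;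
* hypothesis B (averaged, S4′B): `∫_{[0,L)^{3n}} H e^{-bH} ≤ 0`;
* conclusion: `∫_{[0,L)^{3n}} D_{t₀} e^{-bH} ≤ [n g(0) / (2 K₂ (√t₀ − η))] ∫_{[0,L)^{3n}} e^{-bH}`.

Proof. Pointwise `Σ_{i,j} g(X_i − X_j) = n g(0) + 2 H(X)` (diagonal `g(0)`, off-diagonal pairs
counted twice since `g` is even), so with `c = 2 K₂ (√t₀ − η) > 0` (`η < √t₀` from `η² < t₀`)
hypothesis A reads `D_{t₀} ≤ (n g(0) + 2H)/c`; multiply by `e^{-bH} ≥ 0`, integrate over the cell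
(all integrands are continuous, hence integrable on the bounded cell), split by linearity and drop
`(2/c) ∫ H e^{-bH} ≤ 0` by hypothesis B.
-/

namespace Summit.AtomisticToContinuum.BoseEinsteinCondensation.Theorems.CoarseGrainedReverseHolder

open MeasureTheory
open Literature.MathematicalPhysics.QuantumManyBody Literature.MathematicalPhysics.StatisticalMechanics
open BoseGas

namespace StructureFactorBound

/-- **Diagonal/off-diagonal splitting of the Riesz energy**: for every configuration,
`Σ_{i,j} g(X_i − X_j) = n g(0) + 2 Σ_{i<j} g(X_i − X_j)` (`g` is even). -/
theorem sum_sum_periodicRieszKernel_eq_diag_add (s L η : ℝ) {n : ℕ} (X : Config n) :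
    ∑ i : Fin n, ∑ j : Fin n, periodicRieszKernel s L η (X i - X j) =
      (n : ℝ) * periodicRieszKernel s L η 0 +
        2 * ∑ i : Fin n, ∑ j : Fin n with i < j, periodicRieszKernel s L η (X i - X j) := by
  rw [Coulomb.sum_sum_eq_diag_add_two_mul (fun i j => periodicRieszKernel s L η (X i - X j))
    (fun i j => periodicRieszKernel_sub_comm s L η (X i) (X j))]
  simp only [sub_self, Finset.sum_const, Finset.card_univ, Fintype.card_fin, nsmul_eq_mul]

/-- The pair energy `H = Σ_{i<j} g(X_i − X_j)` is continuous (`0 < L`, `η ≠ 0`). -/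
theorem continuous_pairSum {L η : ℝ} (hL : 0 < L) (hη : η ≠ 0) (n : ℕ) :
    Continuous (fun X : Config n => ∑ i : Fin n, ∑ j : Fin n with i < j,
      periodicRieszKernel 2 L η (X i - X j)) :=
  continuous_finsetSum _ fun i _ => continuous_finsetSum _ fun j _ =>
    (continuous_periodicRieszKernel 2 hL hη).comp ((continuous_apply i).sub (continuous_apply j))

/-- The heat-smoothed density fluctuation `D_t = Σ_{i,j} Θ_{L,t}(X_i − X_j)` is continuous
(`0 < L`, `0 < t`). -/
theorem continuous_heatSumSum {L t : ℝ} (hL : 0 < L) (ht : 0 < t) (n : ℕ) :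
    Continuous (fun X : Config n => ∑ i : Fin n, ∑ j : Fin n, periodicHeatSum L t (X i - X j)) :=
  continuous_finsetSum _ fun i _ => continuous_finsetSum _ fun j _ =>
    (continuous_periodicHeatSum hL ht).comp ((continuous_apply i).sub (continuous_apply j))

end StructureFactorBound

/-- **S4′C — assembly of the classical engine in variance form.** From the pointwise domination
`2 K₂ (√t₀ − η) D_{t₀} ≤ Σ_{i,j} g(X_i − X_j)` (S4′A) and the non-positivity of the Gibbs mean
energy `∫_{[0,L)^{3n}} H e^{-bH} ≤ 0` (S4′B) follows the `L`-uniform smooth structure-factor bound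
`∫_{[0,L)^{3n}} D_{t₀} e^{-bH} ≤ [n g(0) / (2 K₂ (√t₀ − η))] ∫_{[0,L)^{3n}} e^{-bH}` for every
`b ≥ 0`, `0 < η`, `η² < t₀`: pointwise `Σ_{i,j} g(X_i − X_j) = n g(0) + 2H`, multiply by
`e^{-bH} ≥ 0`, integrate, and drop the non-positive `H`-term. -/
theorem stub_structureFactorBound_of : (∀ (n : ℕ) (L η t₀ : ℝ), 0 < L → 0 < η → η ^ 2 < t₀ → ∀ X : BoseGas.Config n, 2 * rieszSubordinationConst 2 * (Real.sqrt t₀ - η) * ∑ i : Fin n, ∑ j : Fin n, periodicHeatSum L t₀ (X i - X j) ≤ ∑ i : Fin n, ∑ j : Fin n, periodicRieszKernel 2 L η (X i - X j)) → (∀ (n : ℕ) (L b η : ℝ), 0 < L → 0 ≤ b → 0 < η → ∀ H : BoseGas.Config n → ℝ, H = (fun X => ∑ i : Fin n, ∑ j : Fin n with i < j, periodicRieszKernel 2 L η (X i - X j)) → ∫ X in BoseGas.cellN n L, H X * Real.exp (-(b * H X)) ≤ 0) → ∀ (n : ℕ) (L b η t₀ : ℝ), 0 < L → 0 ≤ b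 → 0 < η → η ^ 2 < t₀ → ∀ H : BoseGas.Config n → ℝ, H = (fun X => ∑ i : Fin n, ∑ j : Fin n with i < j, periodicRieszKernel 2 L η (X i - X j)) → ∫ X in BoseGas.cellN n L, (∑ i : Fin n, ∑ j : Fin n, periodicHeatSum L t₀ (X i - X j)) * Real.exp (-(b * H X)) ≤ (n : ℝ) * periodicRieszKernel 2 L η 0 / (2 * rieszSubordinationConst 2 * (Real.sqrt t₀ - η)) * ∫ X in BoseGas.cellN n L, Real.exp (-(b * H X)) := by
  intro hA hB n L b η t₀ hL hb hη ht₀ H hH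
  have hη0 : η ≠ 0 := hη.ne'
  have ht₀0 : 0 < t₀ := (by positivity : 0 < η ^ 2).trans ht₀
  have hK : 0 < rieszSubordinationConst 2 := rieszSubordinationConst_pos two_pos
  have hsq : 0 < Real.sqrt t₀ - η := sub_pos.2 (Real.lt_sqrt_of_sq_lt ht₀)
  have hc : 0 < 2 * rieszSubordinationConst 2 * (Real.sqrt t₀ - η) := by positivity
  -- notation
  set c : ℝ := 2 * rieszSubordinationConst 2 * (Real.sqrt t₀ - η) with hc_def
  set g0 : ℝ := periodicRieszKernel 2 L η 0 with hg0_def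
  set D : Config n → ℝ := fun X => ∑ i : Fin n, ∑ j : Fin n, periodicHeatSum L t₀ (X i - X j)
    with hD_def
  -- continuity and integrability on the bounded cell
  have hHc : Continuous H := by
    rw [hH]
    exact StructureFactorBound.continuous_pairSum hL hη0 n
  have hDc : Continuous D := StructureFactorBound.continuous_heatSumSum hL ht₀0 n
  have hEc : Continuous fun X => Real.exp (-(b * H X)) :=
    Real.continuous_exp.comp (continuous_const.mul hHc).neg
  have hiE : IntegrableOn (fun X => Real.exp (-(b * H X))) (cellN n L) volume :=
    integrableOn_cellN hEc L
  have hiHE : IntegrableOn (fun X => H X * Real.exp (-(b * H X))) (cellN n L) volume :=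
    integrableOn_cellN (hHc.mul hEc) L
  have hiDE : IntegrableOn (fun X => D X * Real.exp (-(b * H X))) (cellN n L) volume :=
    integrableOn_cellN (hDc.mul hEc) L
  have hi1 : IntegrableOn (fun X => ((n : ℝ) * g0 / c) * Real.exp (-(b * H X))) (cellN n L)
      volume := hiE.const_mul _
  have hi2 : IntegrableOn (fun X => (2 / c) * (H X * Real.exp (-(b * H X)))) (cellN n L)
      volume := hiHE.const_mul _
  -- the pointwise bound `D e^{-bH} ≤ ((n g0 + 2 H) / c) e^{-bH}`
  have hsplit : ∀ X : Config n,
      ∑ i : Fin n, ∑ j : Fin n, periodicRieszKernel 2 L η (X i - X j) = (n : ℝ) * g0 + 2 * H X := by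
    intro X
    rw [StructureFactorBound.sum_sum_periodicRieszKernel_eq_diag_add 2 L η X, hH]
  have hpt : ∀ X : Config n, D X * Real.exp (-(b * H X)) ≤
      ((n : ℝ) * g0 / c) * Real.exp (-(b * H X)) + (2 / c) * (H X * Real.exp (-(b * H X))) := by
    intro X
    have h1 : c * D X ≤ (n : ℝ) * g0 + 2 * H X := (hsplit X) ▸ hA n L η t₀ hL hη ht₀ X
    have h2 : D X ≤ ((n : ℝ) * g0 + 2 * H X) / c := by
      rw [le_div_iff₀ hc, mul_comm]
      exact h1
    have h3 : D X * Real.exp (-(b * H X)) ≤ ((n : ℝ) * g0 + 2 * H X) / c * Real.exp (-(b * H X)) :=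
      mul_le_mul_of_nonneg_right h2 (Real.exp_pos _).le
    have h4 : ((n : ℝ) * g0 + 2 * H X) / c * Real.exp (-(b * H X)) =
        ((n : ℝ) * g0 / c) * Real.exp (-(b * H X)) + (2 / c) * (H X * Real.exp (-(b * H X))) := by
      field_simp
    exact h4 ▸ h3
  -- integrate over the cell and use hypothesis B
  have hB' : ∫ X in cellN n L, H X * Real.exp (-(b * H X)) ≤ 0 := hB n L b η hL hb hη H hH
  have h2c : 0 ≤ 2 / c := div_nonneg zero_le_two hc.le
  calc ∫ X in cellN n L, D X * Real.exp (-(b * H X))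
      ≤ ∫ X in cellN n L, (((n : ℝ) * g0 / c) * Real.exp (-(b * H X)) +
          (2 / c) * (H X * Real.exp (-(b * H X)))) := integral_mono hiDE (hi1.add hi2) hpt
    _ = ((n : ℝ) * g0 / c) * (∫ X in cellN n L, Real.exp (-(b * H X))) +
          (2 / c) * (∫ X in cellN n L, H X * Real.exp (-(b * H X))) := by
        rw [integral_add hi1 hi2, integral_const_mul, integral_const_mul]
    _ ≤ ((n : ℝ) * g0 / c) * (∫ X in cellN n L, Real.exp (-(b * H X))) :=
        add_le_of_nonpos_right (mul_nonpos_of_nonneg_of_nonpos h2c hB')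

end Summit.AtomisticToContinuum.BoseEinsteinCondensation.Theorems.CoarseGrainedReverseHolder
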